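import Summits.QuantumFields.BalabanUV.Beta.GAN24.T2RecSourceRows

/-!
# `BalabanUV.Beta.GAN24.T2RecSourceRowsSlot` — binder row G-an2-4 ∕ (CONV-C), TRANSFER-III (the (α-0) chain at row D1's literal of record (III′)), the source rows: **road-P2
# g35's (F4) SOURCE-ROW SOCKETS WITH GENERIC SLOTS** — the `T̃`-free source `b̃_j = (cE₂·Lc^{2(d+1)}) • mmRead (K3OfK G̃_j S̃_j M̃_j (W2SymOfK G̃_j S̃_j M̃_j 0 M̃₂,j)) + cB • vh₂S` of
# the `T₂` recursion is `j`-uniformly `LocStencil₂` and Cauchy at a geometric rate, AS FUNCTIONS of: a uniform (∧ Cauchy) unit row of ANY kernel family `K`, the same for ANY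
# first-order table family `S`, a multiplier family `M` whose unit table is a `j`-free vertex family `Mu` (letters `hMu hCMu`), the mixed-table letters, the border's class —
# p2 g35's (E) `T2RecSourceRows` §1 (there `K♮ᴱ_j = unitK_j (coDressKBmAt ρ Lc (KInvStep Lc j))`, `S′ = SpureRecAt ρ`, `M = M1At ρ cΛ` with `unitM_M1At_eq`) re-typed by STATIC
# substitution of its text (G-an2-4 CRUX TEAM (2), leaf prover `b2b-balaban-gan24-formalise-leaf-01`, gen 82 — crew GAN's kept leaf prover; road-P2 seatless after g56, its
# socket typed in order; the record instance = `GAN24/CombT2RecSourceRows`; no existing file touched)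

NOT IN PRINT; OUR BOOKKEEPING ([folklore] composition BY NAME — the (E) §1 proofs token for token over the SAME engines (leaf-19's `locStencil₂_mmRead_K3OfK_family`, leaf-08's
`mmRead_K3OfK_cauchy`, an1's `vertexFamily₂_W2SymOfK`, leaf-07's `vertexFamily₂_W2SymOfK_sub`, `unitM₂_M2Of_eq`); 0 `def`, 0 cited facts, 0 `def … : Prop`, 0 sorry).
HONEST FRAMING (cell contract, verbatim): «discharging `BetaPertH` makes Bałaban's UV stability UNCONDITIONAL — a real constructive-QFT result; it is NOT the continuum limit and
NOT the Clay problem.»  HONEST DEPENDENCY (verbatim): «continuum YM on T⁴ ⇐ BetaPertH ∧ nine spine estimates (0/9 proved); BetaPertH ⇐ (D1) ∧ (D4) ∧ CAP+tail; G-an2-4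
gates asym, D1 and NE2/3/4.»

* `vertexFamily₂_zeroCarrier_of_rows_slot` ∕ `…_cauchy_of_rows_slot` — the zero-`T₂` carrier `W2SymOfK (unitK_j (K j)) Lc (unitS_j (S j)) (unitM_j (M j)) 0 (unitM₂_j (M2Of mixFF j))`
  is `j`-uniformly a vertex family ∧ Cauchy at a geometric rate.
* **`source_shape_of_rows_slot`** ((F4a): `∃ Cb δb > 0, ∀ j, LocStencil₂ (b̃_j) Cb δb`) and **`source_cauchy_of_rows_slot`** ((F4b): `∃ cb θb δb, … ∀ k j, LocStencil₂ (b̃_{k+j} − b̃_k)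
  (cb·θb^k) δb`).
Every displayed row is a HYPOTHESIS; asserts NO value of Bałaban's tables; NEVER «G-an2-4 closed» as (CONV-C); NOT D1, NOT `BetaPertH`, NOT continuum, NOT Clay.  2026-08-25.
-/

noncomputable section

open Finset
open scoped BigOperators
open Literature.MathematicalPhysics.QuantumFieldTheory
open Literature.MathematicalPhysics.QuantumFieldTheory.Balaban1983to89
open Literature.MathematicalPhysics.QuantumFieldTheory.Balaban1983to89.Beta
open B12Sec2to5 (l1 l1_nonneg)
open ExpKernelCalculus (MKer Decays BiLoc VertexFamily VertexFamily₂)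
open OneStepResolventKernel (Fib LocStencil decays_mono biLoc_mono)
open AffineAveraging (box toSite)
open BalabanStepJets (locStencil_mono vertexFamily₂_mono)
open BalabanStepJetsSucc (mmRead)
open BalabanCompositeJets (LocStencil₂)
open SecondOrderResponse (W2SymOfK W2SymOfK_swap LocStencilFM vertexFamily₂_W2SymOfK CW2)
open BalabanStepW2 (M2Of K3OfK locStencil₂_smul' locStencil₂_add' biLoc_le_mono)
open Summit.QuantumFields.BalabanUV.Beta.HessKerDressedUnits (unitK unitS unitW)
open Summit.QuantumFields.BalabanUV.Beta.SecondOrderUnits (unitM unitS₂ unitM₂)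
open Summit.QuantumFields.BalabanUV.Beta.GAN24.CombesThomas (sfStep smStep)
open Summit.QuantumFields.BalabanUV.Beta.GAN24.StencilSlotOfShapes (locStencil_mono')
open Summit.QuantumFields.BalabanUV.Beta.GAN24.WSlotOfShapes (unitM₂_M2Of_eq locStencilFM_unitM₂_M2Of)
open Summit.QuantumFields.BalabanUV.Beta.GAN24.WSlotCauchyOfShapes (locStencil₂_le_mono vertexFamily_zero locStencilFM_zero mul_pow_le_mul_pow)
open Summit.QuantumFields.BalabanUV.Beta.GAN24.SecondOrderLipschitzW2 (LW2 LW2_mul vertexFamily₂_W2SymOfK_sub)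
open Summit.QuantumFields.BalabanUV.Beta.GAN24.T2SlotOfHW (locStencil₂_mmRead_K3OfK_family)
open Summit.QuantumFields.BalabanUV.Beta.GAN24.ValueReadoutLipschitz (lK3 lK3_nonneg mmRead_K3OfK_cauchy)
open Summit.QuantumFields.BalabanUV.Beta.GAN24.W3SourceRows (locStencil₂_zero_table smul_add_sub_smul_add)

namespace Summit.QuantumFields.BalabanUV.Beta.GAN24.T2RecSourceRowsSlot

variable {d : ℕ} {Lc : ℕ} [NeZero Lc]

/-! ## §1 Generic `d`, generic slots: the zero-`T₂` carrier, then the source rows -/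
section Generic
variable {K : ℕ → MKer (d + 1) (Fib d)} {S : ℕ → Fin (d + 1) → (Fin (d + 1) → ℤ) → MKer (d + 1) (Fib d)}
  {M : ℕ → Fin (d + 1) → (Fin (d + 1) → ℤ) → MKer (d + 1) (Fib d)} {Mu : Fin (d + 1) → (Fin (d + 1) → ℤ) → MKer (d + 1) (Fib d)} {CMu : ℝ → ℝ}
  {mixFF : Fin (d + 1) → (Fin (d + 1) → ℤ) → Fin (d + 1) → (Fin (d + 1) → ℤ) → MKer (d + 1) (Fib d)}

/-- [folklore] **THE ZERO-`T₂` CARRIER IS `j`-UNIFORMLY A VERTEX FAMILY** — p2 g35's `vertexFamily₂_zeroCarrier_of_rows` with the kernels `unitK_j (K j)`, the tables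
`unitS_j (S j)` and a multiplier slot whose unit table is `j`-free (`hMu`, a vertex family at every rate: `hCMu`) GENERIC; the mixed slot by `unitM₂_M2Of_eq`. -/
theorem vertexFamily₂_zeroCarrier_of_rows_slot (hMu : ∀ j, unitM (sfStep Lc j) (smStep d Lc j) (M j) = Mu)
    (hCMu : ∀ δ : ℝ, 0 ≤ δ → VertexFamily Mu Lc (CMu δ) δ) {C δ : ℝ}
    (hG : ∀ j, Decays (unitK (sfStep Lc j) (smStep d Lc j) (K j)) C δ) (hδ : 0 < δ)
    {Cs δs : ℝ} (hS : ∀ j, LocStencil (unitS (sfStep Lc j) (smStep d Lc j) (S j)) Cs δs) (hδs : 0 < δs)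
    {CM₂ δ₄ : ℝ} (hmix : LocStencilFM Lc mixFF CM₂ δ₄) (hδ₄ : 0 < δ₄)
    (hfm : ∀ κ u ρ w x z (α μ' : Fin (d + 1)), mixFF κ u ρ w x z (Sum.inl α) (Sum.inr μ') = 0)
    (hm : ∀ κ u ρ w x z (μ' : Fin (d + 1)) (b : Fib d), mixFF κ u ρ w x z (Sum.inr μ') b = 0) :
    ∃ Cw δW : ℝ, 0 < δW ∧ ∀ j, VertexFamily₂ (W2SymOfK (unitK (sfStep Lc j) (smStep d Lc j) (K j)) Lc
      (unitS (sfStep Lc j) (smStep d Lc j) (S j)) (unitM (sfStep Lc j) (smStep d Lc j) (M j)) 0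
      (unitM₂ (sfStep Lc j) (smStep d Lc j) (M2Of d Lc mixFF j))) Lc Cw δW := by
  have hC : 0 ≤ C := (hG 0).nonneg (Sum.inl 0)
  have hCs : 0 ≤ Cs := ((hS 0) 0 0).nonneg (Sum.inl 0)
  set m : ℝ := min (min δ δs) δ₄ with hm_def
  have hm0 : 0 < m := lt_min (lt_min hδ hδs) hδ₄
  have hm4 : m ≤ δ₄ := min_le_right _ _
  have hms : m ≤ δs := (min_le_left _ _).trans (min_le_right _ _)
  have hmK : m ≤ δ := (min_le_left _ _).trans (min_le_left _ _)
  set CM : ℝ := CMu m with hCM_def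
  refine ⟨CW2 d C Cs CM 0 CM₂ m, m / 16, by positivity, fun j => ?_⟩
  have hK' : Decays (unitK (sfStep Lc j) (smStep d Lc j) (K j)) C m :=
    decays_mono (hG j) hC le_rfl hmK
  have hS' : LocStencil (unitS (sfStep Lc j) (smStep d Lc j) (S j)) Cs m :=
    locStencil_mono' (hS j) le_rfl hms
  have hM' : VertexFamily (unitM (sfStep Lc j) (smStep d Lc j) (M j)) Lc CM m := by
    rw [hMu]
    exact hCMu m hm0.le
  have hT' : LocStencil₂ (0 : Fin (d + 1) → (Fin (d + 1) → ℤ) → Fin (d + 1) → (Fin (d + 1) → ℤ) → MKer (d + 1) (Fib d)) 0 m :=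
    locStencil₂_zero_table
  have hX' : LocStencilFM Lc (unitM₂ (sfStep Lc j) (smStep d Lc j) (M2Of d Lc mixFF j)) CM₂ m :=
    (locStencilFM_unitM₂_M2Of hmix hfm hm j).mono hm4
  exact vertexFamily₂_W2SymOfK hK' hC hm0 hS' hM' hT' hX'

/-- [folklore] **THE ZERO-`T₂` CARRIER IS CAUCHY AT A GEOMETRIC RATE** (generic slots; leaf-07's `vertexFamily₂_W2SymOfK_sub`: the `T₂`, multiplier and mixed slots do not
move) — p2 g35's `vertexFamily₂_zeroCarrier_cauchy_of_rows` token for token. -/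
theorem vertexFamily₂_zeroCarrier_cauchy_of_rows_slot (hMu : ∀ j, unitM (sfStep Lc j) (smStep d Lc j) (M j) = Mu)
    (hCMu : ∀ δ : ℝ, 0 ≤ δ → VertexFamily Mu Lc (CMu δ) δ) {C δ cK θK : ℝ}
    (hG : ∀ j, Decays (unitK (sfStep Lc j) (smStep d Lc j) (K j)) C δ)
    (hGall : ∀ k j, Decays (unitK (sfStep Lc (k + j)) (smStep d Lc (k + j)) (K (k + j)) -
      unitK (sfStep Lc k) (smStep d Lc k) (K k)) (cK * θK ^ k) δ)
    (hδ : 0 < δ) (hθK0 : 0 ≤ θK) (hθK1 : θK < 1)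
    {Cs cS θS δs : ℝ} (hS : ∀ j, LocStencil (unitS (sfStep Lc j) (smStep d Lc j) (S j)) Cs δs)
    (hSall : ∀ k j, LocStencil (unitS (sfStep Lc (k + j)) (smStep d Lc (k + j)) (S (k + j)) -
      unitS (sfStep Lc k) (smStep d Lc k) (S k)) (cS * θS ^ k) δs)
    (hδs : 0 < δs) (hθS0 : 0 ≤ θS) (hθS1 : θS < 1)
    {CM₂ δ₄ : ℝ} (hmix : LocStencilFM Lc mixFF CM₂ δ₄) (hδ₄ : 0 < δ₄)
    (hfm : ∀ κ u ρ w x z (α μ' : Fin (d + 1)), mixFF κ u ρ w x z (Sum.inl α) (Sum.inr μ') = 0)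
    (hm : ∀ κ u ρ w x z (μ' : Fin (d + 1)) (b : Fib d), mixFF κ u ρ w x z (Sum.inr μ') b = 0) :
    ∃ cW θW δW : ℝ, 0 ≤ θW ∧ θW < 1 ∧ 0 < δW ∧ ∀ k j, VertexFamily₂
      (W2SymOfK (unitK (sfStep Lc (k + j)) (smStep d Lc (k + j)) (K (k + j))) Lc
          (unitS (sfStep Lc (k + j)) (smStep d Lc (k + j)) (S (k + j)))
          (unitM (sfStep Lc (k + j)) (smStep d Lc (k + j)) (M (k + j))) 0
          (unitM₂ (sfStep Lc (k + j)) (smStep d Lc (k + j)) (M2Of d Lc mixFF (k + j))) -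
        W2SymOfK (unitK (sfStep Lc k) (smStep d Lc k) (K k)) Lc
          (unitS (sfStep Lc k) (smStep d Lc k) (S k)) (unitM (sfStep Lc k) (smStep d Lc k) (M k)) 0
          (unitM₂ (sfStep Lc k) (smStep d Lc k) (M2Of d Lc mixFF k))) Lc (cW * θW ^ k) δW := by
  have hC : 0 ≤ C := (hG 0).nonneg (Sum.inl 0)
  have hcK : 0 ≤ cK := by have h := (hGall 0 0).nonneg (Sum.inl 0); simpa using h
  have hCs : 0 ≤ Cs := ((hS 0) 0 0).nonneg (Sum.inl 0)
  have hcS : 0 ≤ cS := by have h := ((hSall 0 0) 0 0).nonneg (Sum.inl 0); simpa using h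
  have hCM₂ : 0 ≤ CM₂ := hmix.nonneg
  set θW : ℝ := max θK θS with hθW_def
  have hθW0 : 0 ≤ θW := hθK0.trans (le_max_left _ _)
  have hθW1 : θW < 1 := max_lt hθK1 hθS1
  have hKW : θK ≤ θW := le_max_left _ _
  have hSW : θS ≤ θW := le_max_right _ _
  set m : ℝ := min δ (min δs δ₄) with hm_def
  have hm0 : 0 < m := lt_min hδ (lt_min hδs hδ₄)
  have hmδ : m ≤ δ := min_le_left _ _
  have hms : m ≤ δs := (min_le_right _ _).trans (min_le_left _ _)
  have hm4 : m ≤ δ₄ := (min_le_right _ _).trans (min_le_right _ _)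
  set CM : ℝ := CMu m with hCM_def
  have hM : VertexFamily Mu Lc CM m := hCMu m hm0.le
  have hmixm : LocStencilFM Lc mixFF CM₂ m := hmix.mono hm4
  refine ⟨LW2 d C Cs CM 0 CM₂ cK cS 0 0 0 m, θW, m / 16, hθW0, hθW1, by positivity, fun k j => ?_⟩
  have hK1 : Decays (unitK (sfStep Lc (k + j)) (smStep d Lc (k + j)) (K (k + j))) C m :=
    decays_mono (hG (k + j)) hC le_rfl hmδ
  have hK0 : Decays (unitK (sfStep Lc k) (smStep d Lc k) (K k)) C m :=
    decays_mono (hG k) hC le_rfl hmδ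
  have hKK : Decays (unitK (sfStep Lc (k + j)) (smStep d Lc (k + j)) (K (k + j)) -
      unitK (sfStep Lc k) (smStep d Lc k) (K k)) (cK * θW ^ k) m :=
    decays_mono (hGall k j) (by positivity) (mul_pow_le_mul_pow hcK hθK0 hKW k) hmδ
  have hS1 : LocStencil (unitS (sfStep Lc (k + j)) (smStep d Lc (k + j)) (S (k + j))) Cs m :=
    locStencil_mono' (hS (k + j)) le_rfl hms
  have hS0 : LocStencil (unitS (sfStep Lc k) (smStep d Lc k) (S k)) Cs m :=
    locStencil_mono' (hS k) le_rfl hms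
  have hSS : LocStencil (unitS (sfStep Lc (k + j)) (smStep d Lc (k + j)) (S (k + j)) -
      unitS (sfStep Lc k) (smStep d Lc k) (S k)) (cS * θW ^ k) m :=
    locStencil_mono' (hSall k j) (mul_pow_le_mul_pow hcS hθS0 hSW k) hms
  have hT : LocStencil₂ (0 : Fin (d + 1) → (Fin (d + 1) → ℤ) → Fin (d + 1) → (Fin (d + 1) → ℤ) → MKer (d + 1) (Fib d)) 0 m :=
    locStencil₂_zero_table
  have hθk : (0 : ℝ) ≤ 0 * θW ^ k := by positivity
  have hTT : LocStencil₂ ((0 : Fin (d + 1) → (Fin (d + 1) → ℤ) → Fin (d + 1) → (Fin (d + 1) → ℤ) → MKer (d + 1) (Fib d)) - 0) (0 * θW ^ k) m := by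
    rw [sub_self, zero_mul]; exact locStencil₂_zero_table
  have hMM : VertexFamily (Mu - Mu) Lc
      (0 * θW ^ k) m := by
    rw [sub_self]; exact vertexFamily_zero hθk
  have hMM₂ : LocStencilFM Lc (mixFF - mixFF) (0 * θW ^ k) m := by
    rw [sub_self]; exact locStencilFM_zero hθk
  rw [hMu, hMu, unitM₂_M2Of_eq hfm hm, unitM₂_M2Of_eq hfm hm]
  have h := vertexFamily₂_W2SymOfK_sub (N := Lc) hK1 hK0 hKK hm0 hS1 hS0 hSS hM hM hMM hT hT hTT hmixm hmixm hMM₂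
  rw [LW2_mul] at h
  exact h

/-- NOT IN PRINT; OUR BOOKKEEPING — A SOCKET (generic `d`, generic slots).  **ROW (F4a), `LocStencil₂` HALF**: the `T̃`-free source
`b̃_j = (cE₂·Lc^{2(d+1)}) • mmRead Lc (K3OfK (unitK_j (K j)) Lc (unitS_j (S j)) (unitM_j (M j)) (W2SymOfK … 0 (unitM₂_j (M2Of mixFF j)))) + cB • vh₂S` is `j`-UNIFORMLY `LocStencil₂` from the
kernels' uniform unit row `hG`, the tables' `hS`, the multiplier letters `hMu hCMu`, the mixed-table letters and a `LocStencil₂` shape of the border (leaf-19's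
`locStencil₂_mmRead_K3OfK_family`) — p2 g35's `source_shape_of_rows` with `(K♮ᴱ, S′, M1At ρ cΛ) ↦ (unitK ∘ K, unitS ∘ S, M ∕ Mu)` generic. -/
theorem source_shape_of_rows_slot (hLc : 1 ≤ Lc) (hMu : ∀ j, unitM (sfStep Lc j) (smStep d Lc j) (M j) = Mu)
    (hCMu : ∀ δ : ℝ, 0 ≤ δ → VertexFamily Mu Lc (CMu δ) δ) {C δ : ℝ}
    (hG : ∀ j, Decays (unitK (sfStep Lc j) (smStep d Lc j) (K j)) C δ) (hδ : 0 < δ)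
    {Cs δs : ℝ} (hS : ∀ j, LocStencil (unitS (sfStep Lc j) (smStep d Lc j) (S j)) Cs δs) (hδs : 0 < δs)
    {CM₂ δ₄ : ℝ} (hmix : LocStencilFM Lc mixFF CM₂ δ₄) (hδ₄ : 0 < δ₄)
    (hfm : ∀ κ u ρ w x z (α μ' : Fin (d + 1)), mixFF κ u ρ w x z (Sum.inl α) (Sum.inr μ') = 0)
    (hm : ∀ κ u ρ w x z (μ' : Fin (d + 1)) (b : Fib d), mixFF κ u ρ w x z (Sum.inr μ') b = 0)
    {vh₂S : Fin (d + 1) → (Fin (d + 1) → ℤ) → Fin (d + 1) → (Fin (d + 1) → ℤ) → MKer (d + 1) (Fib d)} {CB δB : ℝ}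
    (hB : LocStencil₂ vh₂S CB δB) (hδB : 0 < δB) (cE₂ cB : ℝ) :
    ∃ Cb δb : ℝ, 0 < δb ∧ ∀ j, LocStencil₂ (fun κ u κ' u' =>
      (cE₂ * (Lc : ℝ) ^ (2 * (d + 1))) •
          mmRead Lc (K3OfK (unitK (sfStep Lc j) (smStep d Lc j) (K j)) Lc
            (unitS (sfStep Lc j) (smStep d Lc j) (S j)) (unitM (sfStep Lc j) (smStep d Lc j) (M j))
            (W2SymOfK (unitK (sfStep Lc j) (smStep d Lc j) (K j)) Lc
              (unitS (sfStep Lc j) (smStep d Lc j) (S j)) (unitM (sfStep Lc j) (smStep d Lc j) (M j)) 0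
              (unitM₂ (sfStep Lc j) (smStep d Lc j) (M2Of d Lc mixFF j))) κ u κ' u')
        + cB • vh₂S κ u κ' u') Cb δb := by
  obtain ⟨Cw, δW, hδW, hW0⟩ := vertexFamily₂_zeroCarrier_of_rows_slot hMu hCMu hG hδ hS hδs hmix hδ₄ hfm hm
  have hC : 0 ≤ C := (hG 0).nonneg (Sum.inl 0)
  have hCs : 0 ≤ Cs := ((hS 0) 0 0).nonneg (Sum.inl 0)
  have hCw : 0 ≤ Cw := ((hW0 0) 0 0 0 0).nonneg (Sum.inl 0)
  set m : ℝ := min (min δ δs) (min δW δB) with hm_def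
  have hm0 : 0 < m := lt_min (lt_min hδ hδs) (lt_min hδW hδB)
  have hmW : m ≤ δW := (min_le_right _ _).trans (min_le_left _ _)
  have hmB : m ≤ δB := (min_le_right _ _).trans (min_le_right _ _)
  have hms : m ≤ δs := (min_le_left _ _).trans (min_le_right _ _)
  have hmK : m ≤ δ := (min_le_left _ _).trans (min_le_left _ _)
  set CM : ℝ := CMu m with hCM_def
  have hK' : ∀ j, Decays (unitK (sfStep Lc j) (smStep d Lc j) (K j)) C m :=
    fun j => decays_mono (hG j) hC le_rfl hmK
  have hS' : ∀ j, LocStencil (unitS (sfStep Lc j) (smStep d Lc j) (S j)) Cs m :=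
    fun j => locStencil_mono' (hS j) le_rfl hms
  have hM' : ∀ j, VertexFamily (unitM (sfStep Lc j) (smStep d Lc j) (M j)) Lc CM m := by
    intro j
    rw [hMu]
    exact hCMu m hm0.le
  have hW' : ∀ j, VertexFamily₂ (W2SymOfK (unitK (sfStep Lc j) (smStep d Lc j) (K j)) Lc
      (unitS (sfStep Lc j) (smStep d Lc j) (S j)) (unitM (sfStep Lc j) (smStep d Lc j) (M j)) 0
      (unitM₂ (sfStep Lc j) (smStep d Lc j) (M2Of d Lc mixFF j))) Lc Cw m :=
    fun j => vertexFamily₂_mono (hW0 j) hCw hmW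
  obtain ⟨C', hC', hval⟩ := locStencil₂_mmRead_K3OfK_family (Lc := Lc) hLc hC hm0 hK' hS' hM' hW'
    (fun j μ y ν y' => W2SymOfK_swap _ _ _ _ _ _ μ y ν y')
  have hm128 : m / 128 ≤ δB := by linarith [hmB, hm0]
  refine ⟨|cE₂ * (Lc : ℝ) ^ (2 * (d + 1))| * C' + |cB| * CB, m / 128, by positivity, fun j => ?_⟩
  exact locStencil₂_add' (locStencil₂_smul' _ (hval j)) (locStencil₂_smul' cB (hB.mono hm128))

/-- NOT IN PRINT; OUR BOOKKEEPING — A SOCKET (generic `d`, generic slots).  **ROW (F4b), SOURCE-DIFFERENCE SOCKET**: the source `b̃` is CAUCHY AT A GEOMETRIC RATE —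
`∃ cb θb δb, 0 ≤ cb ∧ 0 ≤ θb < 1 ∧ 0 < δb ∧ ∀ k j, LocStencil₂ (b̃_{k+j} − b̃_k) (cb·θb^k) δb` — from the kernels' uniform AND Cauchy unit rows, the tables' likewise, the
multiplier ∕ mixed letters: the `j`-free border CANCELS; leaf-08's `mmRead_K3OfK_cauchy` ONCE per pair (p2 g35's `source_cauchy_of_rows` token for token, slots generic). -/
theorem source_cauchy_of_rows_slot (hLc : 1 ≤ Lc) (hMu : ∀ j, unitM (sfStep Lc j) (smStep d Lc j) (M j) = Mu)
    (hCMu : ∀ δ : ℝ, 0 ≤ δ → VertexFamily Mu Lc (CMu δ) δ) {C δ cK θK : ℝ}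
    (hG : ∀ j, Decays (unitK (sfStep Lc j) (smStep d Lc j) (K j)) C δ)
    (hGall : ∀ k j, Decays (unitK (sfStep Lc (k + j)) (smStep d Lc (k + j)) (K (k + j)) -
      unitK (sfStep Lc k) (smStep d Lc k) (K k)) (cK * θK ^ k) δ)
    (hδ : 0 < δ) (hθK0 : 0 ≤ θK) (hθK1 : θK < 1)
    {Cs cS θS δs : ℝ} (hS : ∀ j, LocStencil (unitS (sfStep Lc j) (smStep d Lc j) (S j)) Cs δs)
    (hSall : ∀ k j, LocStencil (unitS (sfStep Lc (k + j)) (smStep d Lc (k + j)) (S (k + j)) -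
      unitS (sfStep Lc k) (smStep d Lc k) (S k)) (cS * θS ^ k) δs)
    (hδs : 0 < δs) (hθS0 : 0 ≤ θS) (hθS1 : θS < 1)
    {CM₂ δ₄ : ℝ} (hmix : LocStencilFM Lc mixFF CM₂ δ₄) (hδ₄ : 0 < δ₄)
    (hfm : ∀ κ u ρ w x z (α μ' : Fin (d + 1)), mixFF κ u ρ w x z (Sum.inl α) (Sum.inr μ') = 0)
    (hm : ∀ κ u ρ w x z (μ' : Fin (d + 1)) (b : Fib d), mixFF κ u ρ w x z (Sum.inr μ') b = 0)
    (vh₂S : Fin (d + 1) → (Fin (d + 1) → ℤ) → Fin (d + 1) → (Fin (d + 1) → ℤ) → MKer (d + 1) (Fib d)) (cE₂ cB : ℝ) :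
    ∃ cb θb δb : ℝ, 0 ≤ cb ∧ 0 ≤ θb ∧ θb < 1 ∧ 0 < δb ∧ ∀ k j, LocStencil₂ (fun κ u κ' u' =>
      ((cE₂ * (Lc : ℝ) ^ (2 * (d + 1))) •
          mmRead Lc (K3OfK (unitK (sfStep Lc (k + j)) (smStep d Lc (k + j)) (K (k + j))) Lc
            (unitS (sfStep Lc (k + j)) (smStep d Lc (k + j)) (S (k + j)))
            (unitM (sfStep Lc (k + j)) (smStep d Lc (k + j)) (M (k + j)))
            (W2SymOfK (unitK (sfStep Lc (k + j)) (smStep d Lc (k + j)) (K (k + j))) Lc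
              (unitS (sfStep Lc (k + j)) (smStep d Lc (k + j)) (S (k + j)))
              (unitM (sfStep Lc (k + j)) (smStep d Lc (k + j)) (M (k + j))) 0
              (unitM₂ (sfStep Lc (k + j)) (smStep d Lc (k + j)) (M2Of d Lc mixFF (k + j)))) κ u κ' u')
        + cB • vh₂S κ u κ' u')
      - ((cE₂ * (Lc : ℝ) ^ (2 * (d + 1))) •
          mmRead Lc (K3OfK (unitK (sfStep Lc k) (smStep d Lc k) (K k)) Lc
            (unitS (sfStep Lc k) (smStep d Lc k) (S k)) (unitM (sfStep Lc k) (smStep d Lc k) (M k))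
            (W2SymOfK (unitK (sfStep Lc k) (smStep d Lc k) (K k)) Lc
              (unitS (sfStep Lc k) (smStep d Lc k) (S k)) (unitM (sfStep Lc k) (smStep d Lc k) (M k)) 0
              (unitM₂ (sfStep Lc k) (smStep d Lc k) (M2Of d Lc mixFF k))) κ u κ' u')
        + cB • vh₂S κ u κ' u')) (cb * θb ^ k) δb := by
  -- the zero-`T₂` carrier's uniform and Cauchy rows
  obtain ⟨Cw, δW, hδW, hW0⟩ := vertexFamily₂_zeroCarrier_of_rows_slot hMu hCMu hG hδ hS hδs hmix hδ₄ hfm hm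
  obtain ⟨cW, θW, δW', hθW0, hθW1, hδW', hW0c⟩ :=
    vertexFamily₂_zeroCarrier_cauchy_of_rows_slot hMu hCMu hG hGall hδ hθK0 hθK1 hS hSall hδs hθS0 hθS1 hmix hδ₄ hfm hm
  -- nonnegativity of the data constants
  have hC : 0 ≤ C := (hG 0).nonneg (Sum.inl 0)
  have hcK : 0 ≤ cK := by have h := (hGall 0 0).nonneg (Sum.inl 0); simpa using h
  have hCs : 0 ≤ Cs := ((hS 0) 0 0).nonneg (Sum.inl 0)
  have hcS : 0 ≤ cS := by have h := ((hSall 0 0) 0 0).nonneg (Sum.inl 0); simpa using h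
  have hCw : 0 ≤ Cw := ((hW0 0) 0 0 0 0).nonneg (Sum.inl 0)
  have hcW : 0 ≤ cW := by have h := ((hW0c 0 0) 0 0 0 0).nonneg (Sum.inl 0); simpa using h
  -- the common ratio and the common rate
  set θb : ℝ := max θK (max θS θW) with hθb_def
  have hθb0 : 0 ≤ θb := hθK0.trans (le_max_left _ _)
  have hθb1 : θb < 1 := max_lt hθK1 (max_lt hθS1 hθW1)
  have hKb : θK ≤ θb := le_max_left _ _
  have hSb : θS ≤ θb := (le_max_left _ _).trans (le_max_right _ _)
  have hWb : θW ≤ θb := (le_max_right _ _).trans (le_max_right _ _)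
  set m : ℝ := min δ (min δs (min δW δW')) with hm_def
  have hm0 : 0 < m := lt_min hδ (lt_min hδs (lt_min hδW hδW'))
  have hmδ : m ≤ δ := min_le_left _ _
  have hms : m ≤ δs := (min_le_right _ _).trans (min_le_left _ _)
  have hmW : m ≤ δW := (min_le_right _ _).trans ((min_le_right _ _).trans (min_le_left _ _))
  have hmW' : m ≤ δW' := (min_le_right _ _).trans ((min_le_right _ _).trans (min_le_right _ _))
  -- the data families at the common rate and ratio
  set CM : ℝ := CMu m with hCM_def
  have hK1 : ∀ j, Decays (unitK (sfStep Lc j) (smStep d Lc j) (K j)) C m :=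
    fun j => decays_mono (hG j) hC le_rfl hmδ
  have hKc : ∀ k j, Decays (unitK (sfStep Lc (k + j)) (smStep d Lc (k + j)) (K (k + j)) -
      unitK (sfStep Lc k) (smStep d Lc k) (K k)) (cK * θb ^ k) m :=
    fun k j => decays_mono (hGall k j) (by positivity) (mul_pow_le_mul_pow hcK hθK0 hKb k) hmδ
  have hS1 : ∀ j, LocStencil (unitS (sfStep Lc j) (smStep d Lc j) (S j)) Cs m :=
    fun j => locStencil_mono' (hS j) le_rfl hms
  have hSc : ∀ k j, LocStencil (unitS (sfStep Lc (k + j)) (smStep d Lc (k + j)) (S (k + j)) -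
      unitS (sfStep Lc k) (smStep d Lc k) (S k)) (cS * θb ^ k) m :=
    fun k j => locStencil_mono' (hSall k j) (mul_pow_le_mul_pow hcS hθS0 hSb k) hms
  have hM1 : ∀ j, VertexFamily (unitM (sfStep Lc j) (smStep d Lc j) (M j)) Lc CM m := by
    intro j
    rw [hMu]
    exact hCMu m hm0.le
  have hMc : ∀ k j, VertexFamily (unitM (sfStep Lc (k + j)) (smStep d Lc (k + j)) (M (k + j)) -
      unitM (sfStep Lc k) (smStep d Lc k) (M k)) Lc (0 * θb ^ k) m := by
    intro k j
    rw [hMu, hMu, sub_self]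
    exact vertexFamily_zero (by positivity)
  have hW1 : ∀ j, VertexFamily₂ (W2SymOfK (unitK (sfStep Lc j) (smStep d Lc j) (K j)) Lc
      (unitS (sfStep Lc j) (smStep d Lc j) (S j)) (unitM (sfStep Lc j) (smStep d Lc j) (M j)) 0
      (unitM₂ (sfStep Lc j) (smStep d Lc j) (M2Of d Lc mixFF j))) Lc Cw m :=
    fun j => vertexFamily₂_mono (hW0 j) hCw hmW
  have hWc : ∀ k j, VertexFamily₂
      (W2SymOfK (unitK (sfStep Lc (k + j)) (smStep d Lc (k + j)) (K (k + j))) Lc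
          (unitS (sfStep Lc (k + j)) (smStep d Lc (k + j)) (S (k + j)))
          (unitM (sfStep Lc (k + j)) (smStep d Lc (k + j)) (M (k + j))) 0
          (unitM₂ (sfStep Lc (k + j)) (smStep d Lc (k + j)) (M2Of d Lc mixFF (k + j))) -
        W2SymOfK (unitK (sfStep Lc k) (smStep d Lc k) (K k)) Lc
          (unitS (sfStep Lc k) (smStep d Lc k) (S k)) (unitM (sfStep Lc k) (smStep d Lc k) (M k)) 0
          (unitM₂ (sfStep Lc k) (smStep d Lc k) (M2Of d Lc mixFF k))) Lc (cW * θb ^ k) m :=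
    fun k j μ y ν y' => biLoc_le_mono (hW0c k j μ y ν y') (by positivity) (mul_pow_le_mul_pow hcW hθW0 hWb k) hmW'
  have hWs : ∀ (j : ℕ) (μ : Fin (d + 1)) (y : Fin (d + 1) → ℤ) (ν : Fin (d + 1)) (y' : Fin (d + 1) → ℤ),
      W2SymOfK (unitK (sfStep Lc j) (smStep d Lc j) (K j)) Lc
          (unitS (sfStep Lc j) (smStep d Lc j) (S j)) (unitM (sfStep Lc j) (smStep d Lc j) (M j)) 0
          (unitM₂ (sfStep Lc j) (smStep d Lc j) (M2Of d Lc mixFF j)) ν y' μ y =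
        W2SymOfK (unitK (sfStep Lc j) (smStep d Lc j) (K j)) Lc
          (unitS (sfStep Lc j) (smStep d Lc j) (S j)) (unitM (sfStep Lc j) (smStep d Lc j) (M j)) 0
          (unitM₂ (sfStep Lc j) (smStep d Lc j) (M2Of d Lc mixFF j)) μ y ν y' :=
    fun j μ y ν y' => W2SymOfK_swap _ _ _ _ _ _ μ y ν y'
  have hCM : 0 ≤ CM := ((hM1 0) 0 0).nonneg (Sum.inl 0)
  have hL : 0 ≤ lK3 d C Cs CM Cw cK cS 0 cW (m / 4) := lK3_nonneg hC hCs hCM hCw hcK hcS le_rfl hcW (by positivity)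
  refine ⟨|cE₂ * (Lc : ℝ) ^ (2 * (d + 1))| * lK3 d C Cs CM Cw cK cS 0 cW (m / 4), θb, m / 128, by positivity, hθb0, hθb1,
    by positivity, fun k j => ?_⟩
  have key := locStencil₂_smul' (cE₂ * (Lc : ℝ) ^ (2 * (d + 1)))
    (mmRead_K3OfK_cauchy hLc hm0 hK1 hKc hS1 hSc hM1 hMc hW1 hWc hWs k j)
  intro κ u κ' u'
  dsimp only
  rw [smul_add_sub_smul_add, show |cE₂ * (Lc : ℝ) ^ (2 * (d + 1))| * lK3 d C Cs CM Cw cK cS 0 cW (m / 4) * θb ^ k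
      = |cE₂ * (Lc : ℝ) ^ (2 * (d + 1))| * (lK3 d C Cs CM Cw cK cS 0 cW (m / 4) * θb ^ k) by ring]
  exact key κ u κ' u'

end Generic

end Summit.QuantumFields.BalabanUV.Beta.GAN24.T2RecSourceRowsSlot

end
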